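import Mathlib
import Literature.MathematicalPhysics.QuantumLattice.GrassmannKernels
import HarnessLib

/-!
# Salmhofer, *Continuous renormalization for fermions and Fermi liquid theory* (CMP 194 (1998) 249):
# §2 the class of models and the Fermi-liquid criterion at `T > 0`; §3–4 the component RGE and its
# power counting (Theorem 1); Theorem 2

Typer file F7b of the `gate-hubbard-kl` statements-first wave (D-0069 (2); DAG rows `Sal98.*`,
HOME/DAG.tsv).  Source: M. Salmhofer, Commun. Math. Phys. **194** (1998) 249–295,
arXiv:cond-mat/9706188 [Salmhofer1998]; locators `p.N Ln` = chunk `pNNNN.txt` line `n` of the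
materialised arXiv TeX (`lit read arxiv:cond-mat/9706188`), NOT printed pages; the stable locators are
the paper's numbers (Definition 1, Proposition 1–2, Lemma 1–2, Theorem 1–2, equations quoted by their
TeX labels where the render lost the numbers).

WHY (DECOMP.md K3 / D1): Definition 1 is the published meaning of "Fermi liquid AT POSITIVE
TEMPERATURE" — convergence of the (skeleton) expansion for `|λ| log β < c₁` plus `β`-UNIFORM `C²`
regularity of the skeleton self-energy — the criterion behind the programme's two-point leaf
(`…Theses.WeakCouplingBCS.H1TwoPointLimitKLScaleD`; compare the tree's named fact
`Literature.MathematicalPhysics.QuantumLattice.bgm_two_point_limit`, whose conclusion is the BGM 2006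
Fermi-liquid FORM of the two-point function for `β⁻¹ ≥ e^{-a/|U|}`, i.e. inside Salmhofer's region
`|λ| log β < c₁`).  Theorems 1–2 are the power-counting bounds of the continuous fermionic RGE with the
Gram (determinant) bound replacing the `i!` of bosonic combinatorics.

## What is typed, and over what

* §2.3 "The class of models" (p.6 L140 – p.7 L35): `ModelData` (lattice spacing, dispersion relation `E`
  on the Brillouin zone — realised as a periodic function on `ℝ^d` —, interaction `v̂`, differentiability
  degree `k₀`, the energy scale `ε₀`) and the predicate `ModelData.Hyp` (`Sal98.H`).  Near-duplicate note:
  these are Salmhofer's `T > 0`, `d`-dimensional lattice hypotheses; the `d = 2` continuum hypotheses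
  A1–A5 of Feldman–Salmhofer–Trubowitz are typed by t4 (`FST2Hypotheses.lean`) and are NOT the same
  predicates (no asymmetry/filling conditions here; evenness `E(-𝐩) = E(𝐩)` IS assumed here).
* §2.6 Definition 1 (p.8 L102–138): `IsFermiLiquid` (`Sal98.D.FL`).  The Green-function objects it
  quantifies over — existence of the thermodynamic limit, convergence of the perturbation expansion of the
  SKELETON Green functions, the skeleton self-energy `Σ_sk(λ,β)` — are "defined precisely in Section 6"
  of the paper (solution of the truncated RGE; DAG file F7c, rows `Sal98.T8/T9/L9/L10`), so here they are
  the fields of an abstract `GreenFunctionData` and Definition 1 is typed as a predicate on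
  `(ModelData, GreenFunctionData)`: its logical SHAPE is exactly the printed one (ref-2 traps: skeleton vs
  full functions kept apart; `c₁, c₂, c₃` INDEPENDENT of `β, λ`; `p₀`-derivatives are the finite
  differences `(β/2π)(Σ(p₀ + 2π/β) - Σ(p₀))`; `k₀ > d`).  Second derivatives are measured by the operator
  norm of `iteratedFDeriv` instead of `max_{|α|=2}` over coordinate multi-indices, and "`Σ_sk|_{{0}×S} ∈
  C^{k₀}(S,ℝ)` with `k₀`-th derivatives `≤ c₃`" (intrinsic derivatives along `S`) by the existence of a real
  `C^{k₀}` extension off the surface whose ambient derivatives of orders `1,…,k₀` are bounded by `c₃` ON `S`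
  — both equivalent to the printed clauses up to constants depending only on `d, k₀` and `S`, which the
  existential quantifier over `c₂, c₃` absorbs (uniformly in `λ, β`).  [Rev. 2, after the cell's
  cross-reads (HOME/xread/F7b-by-t2.md, F7b-by-t5.md): rev. 1 bounded only the TOP-order ambient
  derivative of the extension, which is strictly weaker than print (t5's family `Σ = N(β)𝐩₁`); Lemma 1
  and Theorem 2 now carry the printed `m ≥ 1` (norm (4.4)) and Theorem 2 the quartic model's degree bound
  `m̄(r) ≤ 2r+2`; orientation / chart / `p₀`-range / sign conventions disclosed in the docstrings.]
* §3–§4.1 (p.11–p.15; "Let `Γ` be a finite set", `∫_Γ dX = ε_Γ Σ_X`): the component form of the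
  continuous RGE as an explicit system — kernel families `G_{m,r}(t | X₁…X_m)`, the quadratic term
  `Q_{m,r}` of Proposition 2 ((3.?) `\Qrmtdef` in the determinant form of §4.1, p.14 L44–52), the
  antisymmetrisation `𝔸_m`, the integral equation (3.?) `\icomRGE` (p.12 L155–160), the truncation of
  Theorem 1, the norm `‖·‖` = the TREE's `Literature.MathematicalPhysics.QuantumLattice.kernelNorm`
  (Salmhofer's (4.4), already in `GrassmannKernels.lean` — cited, not restated), the covariance form
  (4.6) `\Dform` of Lemma 2 on `Γ = Λ × N × {1,2}` with `Λ` a discrete torus (finite abelian group,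
  characters `e^{ikx}`), and the NAMED FACTS Lemma 1 (`DeterminantNormBound`, F-079), Lemma 2
  (`CovarianceGramBound`, F-080), **Theorem 1** (`TruncatedPowerCounting`, F-081).
* **Theorem 2** (`ManyFermionGreenFunctionBound`, F-087), p.20 L163–172: typed in the same finite-`Γ`
  layer with "the many-fermion model in `d ≥ 1`" UNFOLDED into the three printed properties of that model
  which the printed proof (p.20 L174–200) invokes — Proposition 4 (`D_t = 0` for `t > log(βε₀)`),
  (5.21)/Corollary 1 (`∫|D̂_t| ≤ 8J₁ε_t`), Lemma 5 (`‖Ḋ_t‖ ≤ Δ₂ e^{td}`) — as explicit hypotheses;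
  establishing those three properties for the concrete covariance (5.9) is the content of DAG rows
  `Sal98.P4 / Sal98.L5` (file F7c).  Finite `(n_τ, L)` as licensed by §5 ¶2 (p.17 L22–29).
* Proposition 1 (the RGE for the generating function) and Proposition 2 (the Wick re-ordering giving
  `Q_{m,r}`) are wave-optional (F-077/F-078) and NOT typed as facts here: Prop. 1 is a statement about
  `t ↦ e^{Δ_{C_t}}` on the tree's `GrassmannAlgebra` (`gaussConv`, `grassmannLaplacian` of
  `GrassmannLaplacian.lean`, where `e^{Δ_C}` is the DEFINITION of Gaussian convolution), and Prop. 2 needs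
  Wick ordering w.r.t. `D_t`; both are recorded in docstrings only.

No `instance`, no `notation`; nothing about the Hubbard model is asserted or denied; no sorry/axiom.
-/

noncomputable section

open MeasureTheory Filter
open scoped Topology

namespace Literature.MathematicalPhysics.QuantumLattice.FermiRG

namespace Salmhofer1998

/-! ### §2.3 The class of models (`Sal98.H`) -/

/-- Spatial momenta `𝐩 ∈ ℝ^d`; the Brillouin zone `𝓑 = ℝ^d / (2π/ε)ℤ^d` is realised through
`(2π/ε)ℤ^d`-periodic functions (p.6 L142–144). `Sal98.H` · Salmhofer 1998 §2.3 · p.6 L142–144.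
[cite: Salmhofer1998, §2.3 (p.6 L142–144)] -/
abbrev Mom (d : ℕ) : Type := Fin d → ℝ

/-- The lattice vector `(2π/ε) n`, `n ∈ ℤ^d`, of the reciprocal lattice of `𝓑`. [cite: Salmhofer1998, §2.3 (p.6 L142–144)] -/
def recipVec {d : ℕ} (latt : ℝ) (n : Fin d → ℤ) : Mom d := fun i => (2 * Real.pi / latt) * (n i : ℝ)

/-- **The data of a many-fermion model** (§2.1–2.3): lattice spacing `ε`, dispersion relation
`E = T̃ - μ` on the Brillouin zone ((2.?) `E(𝐩) = T̃(𝐩) - μ`, p.6 L89–93), the interaction `v̂(p₀, 𝐩)` and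
its `p₀ → ∞` limit, the differentiability degree `k₀`, and the energy scale `ε₀` of the low-energy chart
(p.6 L172 – p.7 L14).  Properties: `ModelData.Hyp`. `Sal98.H` · Salmhofer 1998 §2.3 · p.6 L140 – p.7 L14.
[cite: Salmhofer1998, §2.3 (p.6 L140 – p.7 L14)] -/
structure ModelData (d : ℕ) where
  /-- lattice spacing `ε > 0` -/
  latt : ℝ
  /-- dispersion relation `E : 𝓑 → ℝ` (chemical potential absorbed), as a periodic function on `ℝ^d` -/
  E : Mom d → ℝ
  /-- the interaction `v̂ : ℝ × 𝓑 → ℝ` -/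
  vhat : ℝ → Mom d → ℝ
  /-- the limit `p₀ → ∞` of `v̂` -/
  vhatInf : Mom d → ℝ
  /-- degree of differentiability `k₀` of `E` and `v̂` -/
  k0 : ℕ
  /-- the energy scale `ε₀` where the low-energy behaviour sets in (p.7 L30–31) -/
  eps0 : ℝ

variable {d : ℕ}

/-- The Fermi surface `S = {𝐩 : E(𝐩) = 0}` (p.6 L152–153). `Sal98.H` · Salmhofer 1998 §2.3 · p.6 L152.
[cite: Salmhofer1998, §2.3 (p.6 L152–153)] -/
def ModelData.fermiSurface (M : ModelData d) : Set (Mom d) := M.E ⁻¹' {0}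

/-- The finite-volume momentum lattice `Λ*_L = (2π/(εL)) ℤ^d mod (2π/ε)` with `L` sites per direction,
listed by representatives `n ∈ {0,…,L-1}^d` (p.6 L69–81: `∫_{Λ*} d𝐩 = L^{-d} Σ_{𝐩 ∈ Λ*}`).
[cite: Salmhofer1998, §2.2 (p.6 L69–81)] -/
def latticeMom (latt : ℝ) (L : ℕ) (n : Fin d → Fin L) : Mom d :=
  fun i => (2 * Real.pi / (latt * L)) * ((n i : ℕ) : ℝ)

/-- **The hypotheses of §2.3 on the class of models** (p.6 L144 – p.7 L14), as a predicate (never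
asserted): `k₀ ≥ 2`; `E ∈ C^{k₀}(𝓑, ℝ)` (periodic), `E(-𝐩) = E(𝐩)`; `v̂ ∈ C^{k₀}(ℝ × 𝓑, ℝ)` with all
derivatives up to order `k₀` bounded, `v̂(-p₀,𝐩) = \overline{v̂(p₀,𝐩)}` (for the real-valued `v̂` of the
text: even in `p₀`), `lim_{p₀→∞} v̂` exists and is `C^{k₀}`; `|∇E| ≥ g₀ > 0` on `S`; `S` lies in an
`ε`-independent bounded region and bounds a strictly convex body with positive curvature everywhere;
`∫_{Λ*} d𝐤 1(|E(𝐤)| ≤ 2) ≤ V₁` uniformly in `L`; `E_max = sup |E| < ∞`; and the standing convention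
`0 < ε₀ ≤ 1` (p.7 L12).  ORIENTATION NOTE (cross-reads t2/t5 2026-08-26): `curvature_pos` fixes the sign
`0 < D²E(p)[u,u]` on tangent vectors, i.e. the electron-like orientation in which the Fermi sea
`{E < 0}` is the convex body; print ("strictly convex and has positive curvature everywhere", p.6
L154–157) is orientation-free and its own tight-binding example (p.7 L28–30, "if `μ ≠ td`") includes
hole-like fillings — those are the same statement for `-E`; the predicate as typed is the narrower reading
(harmless below half filling, the programme's window). `Sal98.H` · Salmhofer 1998 §2.3 (hyposuse) ·
p.6 L144 – p.7 L14. [cite: Salmhofer1998, §2.3 (p.6 L144 – p.7 L14)] -/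
structure ModelData.Hyp (M : ModelData d) : Prop where
  latt_pos : 0 < M.latt
  two_le_k0 : 2 ≤ M.k0
  periodic_E : ∀ (p : Mom d) (n : Fin d → ℤ), M.E (p + recipVec M.latt n) = M.E p
  contDiff_E : ContDiff ℝ (M.k0 : ℕ) M.E
  even_E : ∀ p : Mom d, M.E (-p) = M.E p
  periodic_v : ∀ (p₀ : ℝ) (p : Mom d) (n : Fin d → ℤ), M.vhat p₀ (p + recipVec M.latt n) = M.vhat p₀ p
  contDiff_v : ContDiff ℝ (M.k0 : ℕ) fun q : ℝ × Mom d => M.vhat q.1 q.2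
  bounded_v : ∃ C : ℝ, ∀ n : ℕ, n ≤ M.k0 →
    ∀ q : ℝ × Mom d, ‖iteratedFDeriv ℝ n (fun q : ℝ × Mom d => M.vhat q.1 q.2) q‖ ≤ C
  even_v : ∀ (p₀ : ℝ) (p : Mom d), M.vhat (-p₀) p = M.vhat p₀ p
  tendsto_v : ∀ p : Mom d, Tendsto (fun p₀ : ℝ => M.vhat p₀ p) atTop (𝓝 (M.vhatInf p))
  contDiff_vInf : ContDiff ℝ (M.k0 : ℕ) M.vhatInf
  grad_lower : ∃ g₀ : ℝ, 0 < g₀ ∧ ∀ p ∈ M.fermiSurface, g₀ ≤ ‖fderiv ℝ M.E p‖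
  bounded_convex_S : ∃ (R : ℝ) (S₀ : Set (Mom d)) (K : Set (Mom d)),
    S₀ ⊆ Metric.closedBall 0 R ∧ (∀ p, p ∈ M.fermiSurface ↔ ∃ n : Fin d → ℤ, p + recipVec M.latt n ∈ S₀) ∧
      IsCompact K ∧ StrictConvex ℝ K ∧ frontier K = S₀
  curvature_pos : ∀ p ∈ M.fermiSurface, ∀ u : Mom d, u ≠ 0 → fderiv ℝ M.E p u = 0 →
    0 < iteratedFDeriv ℝ 2 M.E p ![u, u]
  volume_bound : ∃ V₁ : ℝ, ∀ L : ℕ, 0 < L →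
    ((Finset.univ.filter fun n : Fin d → Fin L => |M.E (latticeMom M.latt L n)| ≤ 2).card : ℝ) / (L : ℝ) ^ d
      ≤ V₁
  bounded_E : ∃ Emax : ℝ, ∀ p : Mom d, |M.E p| ≤ Emax
  eps0_pos : 0 < M.eps0
  eps0_le_one : M.eps0 ≤ 1

/-- The low-energy chart of §2.3 (p.6 L172 – p.7 L10, a CONSEQUENCE of the hypotheses via [FST1]
Lemma 2.1): a `C²`-diffeomorphism `π : (-2ε₀, 2ε₀) × S^{d-1} → 𝓑` onto a neighbourhood of `S` with
`E(π(ρ,θ)) = ρ` and `|∂_ρ π| ≤ 2/g₀`; recorded as a predicate on a candidate chart `π` (the sphere realised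
as the Euclidean unit vectors `Σ θᵢ² = 1` of `ℝ^d`, Euclidean length of `∂_ρ π`).  Context for `ε₀`; not
used by the facts below; the printed "diffeomorphism ONTO an open neighbourhood of `S`"
(injectivity/surjectivity) is NOT part of this predicate (cross-read t2 2026-08-26; add it where a
consumer needs the chart as a coordinate system).
[cite: Salmhofer1998, §2.3 (p.6 L172 – p.7 L10)] -/
def IsLowEnergyChart (M : ModelData d) (g₀ : ℝ) (π : ℝ → Mom d → Mom d) : Prop :=
  (∀ (ρ : ℝ) (θ : Mom d), |ρ| < 2 * M.eps0 → ∑ i, θ i ^ 2 = 1 → M.E (π ρ θ) = ρ) ∧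
    (∀ (ρ : ℝ) (θ : Mom d), |ρ| < 2 * M.eps0 → ∑ i, θ i ^ 2 = 1 →
      ∑ i, deriv (fun r => π r θ i) ρ ^ 2 ≤ (2 / g₀) ^ 2) ∧
    ContDiffOn ℝ 2 (fun q : ℝ × Mom d => π q.1 q.2) {q | |q.1| < 2 * M.eps0 ∧ ∑ i, q.2 i ^ 2 = 1}

/-! ### §2.6 Definition 1: the Fermi-liquid criterion at positive temperature (`Sal98.D.FL`) -/

/-- **The Green-function data Definition 1 quantifies over** — per coupling `λ` and inverse temperature
`β`: whether the thermodynamic limit of the Green functions exists; whether the perturbation expansion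
of the SKELETON Green functions ("connected amputated `m`-point functions with self-energy insertions
left out … defined precisely in Section 6", p.8 L94–100) converges; and the skeleton self-energy
`Σ_sk(λ,β) : ℝ × 𝓑 → ℂ` ("the second Legendre transform of the two-point function").  Abstract here
(their construction is §5–6 of the paper, DAG file F7c). `Sal98.D.FL` · Salmhofer 1998 §2.6 · p.8 L94–100.
[cite: Salmhofer1998, §2.6 (p.8 L94–100)] -/
structure GreenFunctionData (d : ℕ) where
  /-- `limitExists λ β`: the thermodynamic limit of the Green functions exists at `(λ, β)` -/
  limitExists : ℝ → ℝ → Prop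
  /-- `skeletonConverges λ β`: the perturbation expansion for the skeleton Green functions converges -/
  skeletonConverges : ℝ → ℝ → Prop
  /-- the skeleton self-energy `Σ_sk(λ, β)(p₀, 𝐩)` -/
  sigmaSk : ℝ → ℝ → ℝ → Mom d → ℂ

/-- The finite-difference "derivative" in `p₀` of Definition 1: `(β/2π)(Σ(p₀ + 2π/β, 𝐩) - Σ(p₀, 𝐩))`
(p.8 L136–138; ref-2 trap (iii)). `Sal98.D.FL` · Salmhofer 1998 Definition 1 · p.8 L136–138.
[cite: Salmhofer1998, Definition 1 (p.8 L136–138)] -/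
def matsubaraDiff (β : ℝ) (f : ℝ → ℂ) (p₀ : ℝ) : ℂ :=
  ((β / (2 * Real.pi) : ℝ) : ℂ) * (f (p₀ + 2 * Real.pi / β) - f p₀)

/-- **Definition 1 (p.8 L102–138), the criterion for (equilibrium) Fermi-liquid behaviour at `T > 0`.**
The `d`-dimensional many-fermion system `M` with Green-function data `G` shows Fermi liquid behaviour if
(0) `k₀ > d` (p.8 L129–131); (a) for every `β` the thermodynamic limit of the Green functions exists for
`|λ| < λ₀(β)`; and (b) there are constants `c₁, c₂, c₃ > 0` INDEPENDENT of `β` and `λ` such that: the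
perturbation expansion for the skeleton Green functions converges for all `(λ, β)` with `|λ| log β < c₁`,
and for all `(λ, β)` with `|λ| log β ≤ c₁/2` the skeleton self-energy satisfies
(1) `Σ_sk` is twice differentiable in `p` with all second derivatives bounded by `c₂` (the `p₀`-ones being
the finite differences `matsubaraDiff β`), and (2) `Σ_sk|_{{0}×S} ∈ C^{k₀}(S, ℝ)` with `k₀`-th
derivatives (along `S`) bounded by `c₃` — typed as: a real `C^{k₀}` extension `g` of `Σ_sk(0,·)|_S` exists
whose ambient derivatives of ALL orders `1,…,k₀` are bounded by `c₃` ON `S` (rev. 2, cross-read t5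
2026-08-26: with only the top-order ambient bound of rev. 1 the family `Σ = N(β) 𝐩₁` passed while its
restriction to a curved `S` has unbounded intrinsic derivatives; the present clause is equivalent to the
printed intrinsic one up to constants depending only on `d, k₀, S`, which `∃ c₃` absorbs uniformly in
`λ, β`).  Temperatures range over the paper's standing window `βε₀ ≥ 6` (p.7 L12–14); `p₀` ranges over `ℝ`
(the Matsubara set `π(2ℤ+1)/β` is where the data are meant to be read; for abstract `sigmaSk` this is a
harmless convention), and `ε₀ > 0` is part of `ModelData.Hyp`, which consumers assume alongside.  A
predicate; nothing is asserted — in particular NOT that the models of §2.3 satisfy it ("not within the scope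
of this paper", p.9 L79–83). `Sal98.D.FL` · Salmhofer 1998 Definition 1 · p.8 L102–138.
[cite: Salmhofer1998, Definition 1 (p.8 L102–138)] -/
def IsFermiLiquid (M : ModelData d) (G : GreenFunctionData d) : Prop :=
  d < M.k0 ∧
    (∀ β : ℝ, 6 ≤ β * M.eps0 → ∃ lam₀ : ℝ, 0 < lam₀ ∧ ∀ lam : ℝ, |lam| < lam₀ → G.limitExists lam β) ∧
    ∃ c₁ c₂ c₃ : ℝ, 0 < c₁ ∧ 0 < c₂ ∧ 0 < c₃ ∧
      (∀ (lam β : ℝ), 6 ≤ β * M.eps0 → |lam| * Real.log β < c₁ → G.skeletonConverges lam β) ∧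
      ∀ (lam β : ℝ), 6 ≤ β * M.eps0 → |lam| * Real.log β ≤ c₁ / 2 →
        -- (1) twice differentiable in `p`, second derivatives bounded by `c₂`
        (∀ p₀ : ℝ, Differentiable ℝ (G.sigmaSk lam β p₀) ∧
            Differentiable ℝ (fderiv ℝ (G.sigmaSk lam β p₀))) ∧
          (∀ (a n : ℕ), a + n = 2 → ∀ (p₀ : ℝ) (p : Mom d),
            ‖iteratedFDeriv ℝ n
                (fun q : Mom d => (matsubaraDiff β)^[a] (fun q₀ => G.sigmaSk lam β q₀ q) p₀) p‖ ≤ c₂) ∧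
          -- (2) the restriction to `{0} × S` is real, `C^{k₀}` along `S`, derivatives of orders
          -- `1,…,k₀` bounded by `c₃` on `S` (rev. 2)
          ∃ g : Mom d → ℝ, ContDiff ℝ (M.k0 : ℕ) g ∧
            (∀ j : ℕ, 1 ≤ j → j ≤ M.k0 → ∀ p ∈ M.fermiSurface, ‖iteratedFDeriv ℝ j g p‖ ≤ c₃) ∧
            ∀ p ∈ M.fermiSurface, G.sigmaSk lam β 0 p = (g p : ℂ)

/-! ### §3–§4.1 The component form of the continuous RGE on a finite set `Γ` -/

section ComponentRGE

variable {Γ : Type*} [Fintype Γ] [DecidableEq Γ]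

/-- A family of `m`-point functions `G_{m,r}(t | X₁,…,X_m)` on the finite set `Γ`, indexed by the number
of legs `m`, the order `r` in `λ` and the flow parameter `t ≥ 0` ((3.?) `\expaWO`, p.11 L167 – p.12 L2:
the connected amputated Green functions, coefficients of the Wick-ordered monomials).
`Sal98.T1` · Salmhofer 1998 §3.2 · p.11 L167 – p.12 L2. [cite: Salmhofer1998, §3.2 (p.11 L167 – p.12 L2)] -/
abbrev KernelFamily (Γ : Type*) : Type _ := (m : ℕ) → ℕ → ℝ → (Fin m → Γ) → ℂ

/-- `∫_{Γ^n} dX F(X) = ε_Γ^n Σ_X F(X)` (p.11 L8–13: `∫_Γ dX F = ε_Γ Σ_X F`).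
[cite: Salmhofer1998, §3 (p.11 L8–13)] -/
def gInt (ε : ℝ) {n : ℕ} (F : (Fin n → Γ) → ℂ) : ℂ := ((ε ^ n : ℝ) : ℂ) * ∑ X : Fin n → Γ, F X

/-- The `i × i` matrix `𝒟_t^{(i)}(V, W)_{kl} = D_t(V_k, W_l)` (Proposition 2, p.12 L104–106).
[cite: Salmhofer1998, Proposition 2 (p.12 L104–106)] -/
def covMatrix (D : Γ → Γ → ℂ) {i : ℕ} (V W : Fin i → Γ) : Matrix (Fin i) (Fin i) ℂ :=
  Matrix.of fun k l => D (V k) (W l)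

/-- The index set `𝓜_{r₁r₂m}` of Proposition 2 (p.12 L95–98): `(m₁, m₂, i)` with `i ≥ 1`,
`1 ≤ m₁ ≤ m̄(r₁)`, `1 ≤ m₂ ≤ m̄(r₂)`, `m₁ + m₂ = m + 2i`, `m₁, m₂` even (as a Boolean test); `m̄(r)` is the
degree of the order-`r` effective action (p.11 L172). [cite: Salmhofer1998, Proposition 2 (p.12 L95–98)] -/
def MIndex (mbar : ℕ → ℕ) (r₁ r₂ m m₁ m₂ i : ℕ) : Bool :=
  decide (1 ≤ i) && decide (1 ≤ m₁) && decide (m₁ ≤ mbar r₁) && decide (1 ≤ m₂) && decide (m₂ ≤ mbar r₂) &&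
    decide (m₁ + m₂ = m + 2 * i) && decide (m₁ % 2 = 0) && decide (m₂ % 2 = 0)

/-- The weights `κ_{m₁m₂i} = C(m₁,i) C(m₂,i)` of `∫ dκ_{mr}` (p.12 L93–94).
[cite: Salmhofer1998, Proposition 2 (p.12 L93–94)] -/
def kappa (m₁ m₂ i : ℕ) : ℕ := Nat.choose m₁ i * Nat.choose m₂ i

/-- `∫ dκ_{mr} F = Σ_{r₁+r₂ = r, r₁,r₂ ≥ 1} Σ_{(m₁,m₂,i) ∈ 𝓜_{r₁r₂m}} κ_{m₁m₂i} F(r₁,m₁,r₂,m₂,i)`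
((3.?) p.12 L81–95), as a finite sum (all indices are bounded by `m̄` and `m`). [cite: Salmhofer1998, Proposition 2 (p.12 L81–95)] -/
def kappaSum (mbar : ℕ → ℕ) (m r : ℕ) (F : ℕ → ℕ → ℕ → ℕ → ℕ → ℂ) : ℂ :=
  ∑ r₁ ∈ Finset.Icc 1 (r - 1),
    ∑ m₁ ∈ Finset.Icc 1 (mbar r₁), ∑ m₂ ∈ Finset.Icc 1 (mbar (r - r₁)),
      ∑ i ∈ Finset.Icc 1 (m₁ + m₂),
        if MIndex mbar r₁ (r - r₁) m m₁ m₂ i = true then (kappa m₁ m₂ i : ℂ) * F r₁ m₁ (r - r₁) m₂ i else 0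

/-- The bilinear term of the component RGE in the form of §4.1 ((4.3), p.14 L44–52, obtained from
Proposition 2 by differentiating the determinant):
`Q_{m,r}(t | X) = ∫dκ_{mr} i² ∫dV dW Ḋ_t(V,W) ∫dY dZ det 𝒟_t^{(i-1)}(Y,Z) G_{m₁r₁}(t | X₁,Y,V) G_{m₂r₂}(t | W,Z̃,X₂)`
with `X₁ = (X₁,…,X_{m₁-i})`, `X₂ = (X_{m₁-i+1},…,X_m)`, `Z̃` = `Z` reversed.  The two factors are supplied
separately (`G₁`, `G₂`) so that the truncation of Theorem 1 can substitute frozen vertices.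
`Sal98.T1` · Salmhofer 1998 Proposition 2 / (4.3) · p.12 L69–106, p.14 L44–52.
[cite: Salmhofer1998, Proposition 2 (p.12 L69–106) and (4.3) (p.14 L44–52)] -/
def quadTerm (ε : ℝ) (mbar : ℕ → ℕ) (D Ddot : ℝ → Γ → Γ → ℂ) (G₁ G₂ : KernelFamily Γ) (m r : ℕ)
    (t : ℝ) (X : Fin m → Γ) : ℂ :=
  kappaSum mbar m r fun r₁ m₁ r₂ m₂ i =>
    if h : i ≤ m₁ ∧ i ≤ m₂ ∧ m₁ + m₂ = m + 2 * i then
      ((i : ℂ) ^ 2) *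
        gInt ε (fun VW : Fin 2 → Γ =>
          Ddot t (VW 0) (VW 1) *
            gInt ε (fun Y : Fin (i - 1) → Γ =>
              gInt ε (fun Z : Fin (i - 1) → Γ =>
                (covMatrix (D t) Y Z).det *
                  G₁ m₁ r₁ t (fun j : Fin m₁ =>
                    if hj : j.val < m₁ - i then X ⟨j.val, by omega⟩
                    else if hj' : j.val - (m₁ - i) < i - 1 then Y ⟨j.val - (m₁ - i), hj'⟩
                    else VW 0) *
                  G₂ m₂ r₂ t (fun j : Fin m₂ =>
                    if hj : j.val = 0 then VW 1
                    else if hj' : j.val - 1 < i - 1 then Z ⟨(i - 2) - (j.val - 1), by omega⟩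
                    else X ⟨(m₁ - i) + (j.val - i), by omega⟩))))
    else 0

/-- The antisymmetrisation `(𝔸_m f)(X₁,…,X_m) = (1/m!) Σ_π sgn(π) f(X_{π(1)},…,X_{π(m)})` ((3.?) p.12
L116–122). [cite: Salmhofer1998, §3.2 (p.12 L116–122)] -/
def antisym {m : ℕ} (f : (Fin m → Γ) → ℂ) (X : Fin m → Γ) : ℂ :=
  ((m.factorial : ℝ)⁻¹ : ℝ) • ∑ π : Equiv.Perm (Fin m), ((Equiv.Perm.sign π : ℤ) : ℂ) * f (X ∘ π)

/-- **The component RGE as an integral equation** ((3.?) `\icomRGE`, p.12 L152–160):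
`G_{m,r}(t | X) = G_{m,r}(0 | X) + ½ 𝔸_m ∫_0^t ds Q_{m,r}(s | X)`, with the bilinear term built from the
family itself on both sides (the full, untruncated flow). `Sal98.T2` · Salmhofer 1998 (3.?) · p.12 L152–160.
[cite: Salmhofer1998, §3.2–3.3 (p.12 L108–160)] -/
def IsRGESolution (ε : ℝ) (mbar : ℕ → ℕ) (D Ddot : ℝ → Γ → Γ → ℂ) (G : KernelFamily Γ) : Prop :=
  ∀ (m r : ℕ) (t : ℝ), 0 ≤ t → ∀ X : Fin m → Γ,
    G m r t X = G m r 0 X + (2 : ℂ)⁻¹ * antisym (fun Y => ∫ s in (0 : ℝ)..t, quadTerm ε mbar D Ddot G G m r s Y) X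

/-- The frozen factors of the truncation of Theorem 1 (p.15 L26–29): in the bilinear term only
`m₁, m₂ ≥ 4` are kept and every four-legged `G_{4,r_k}` is replaced by `v δ_{r_k,1}`, `v = G_{4,1}(0)` the
bare quartic vertex. [cite: Salmhofer1998, Theorem 1 (p.15 L26–29)] -/
def truncFactor (G : KernelFamily Γ) : KernelFamily Γ := fun m r t X =>
  if h : m = 4 then (if r = 1 then G 4 1 0 (fun j => X (Fin.cast h.symm j)) else 0)
  else if m < 4 then 0 else G m r t X

/-- **The truncated flow of Theorem 1**: `G̃` solves the component RGE with initial condition `G̃(0) = G(0)`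
and with `∫ dκ̃_{mr}` (p.15 L26–31): `m₁, m₂ ≥ 4`, four-legged insertions frozen to `v δ_{r,1}`.
`Sal98.T1` · Salmhofer 1998 Theorem 1 · p.15 L26–32. [cite: Salmhofer1998, Theorem 1 (p.15 L26–32)] -/
def IsTruncatedRGESolution (ε : ℝ) (mbar : ℕ → ℕ) (D Ddot : ℝ → Γ → Γ → ℂ) (G : KernelFamily Γ) : Prop :=
  ∀ (m r : ℕ) (t : ℝ), 0 ≤ t → ∀ X : Fin m → Γ,
    G m r t X = G m r 0 X +
      (2 : ℂ)⁻¹ * antisym (fun Y => ∫ s in (0 : ℝ)..t,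
        quadTerm ε mbar D Ddot (truncFactor G) (truncFactor G) m r s Y) X

/-- The norm `‖F_m‖ = max_p sup_{X_p} ∫ ∏_{q ≠ p} dX_q |F_m(X₁,…,X_m)|` of (4.4) (p.14 L54–61, the norm of
[GK]) — this IS the tree's `Literature.MathematicalPhysics.QuantumLattice.kernelNorm` (GrassmannKernels.lean;
cited, not restated). [cite: Salmhofer1998, §4.1 (4.4) (p.14 L54–61)] -/
abbrev sNorm (ε : ℝ) {m : ℕ} (F : (Fin m → Γ) → ℂ) : ℝ :=
  Literature.MathematicalPhysics.QuantumLattice.kernelNorm ε m F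

/-- The two-point kernel `Ḋ_t` as a `2`-point function (for `‖Ḋ_t‖`). [cite: Salmhofer1998, §4.1 (p.14 L54–61)] -/
def twoPt (A : Γ → Γ → ℂ) : (Fin 2 → Γ) → ℂ := fun X => A (X 0) (X 1)

/-- **Lemma 1 (p.14 L63–76)**, as printed (wave-optional licence F-079): if
`sup_{Y,Z} |det 𝒟_t^{(i-1)}(Y,Z)| ≤ A_{i-1}(t)`, then
`‖Q_{m,r}(t)‖ ≤ ∫dκ_{mr} i² A_{i-1}(t) ‖Ḋ_t‖ ‖G_{m₁r₁}(t)‖ ‖G_{m₂r₂}(t)‖` — for the bilinear term built from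
any two families (in the paper: the Green functions themselves), for `m ≥ 1` legs (the norm (4.4) is
`max_{p ∈ ℕ_m} …`, p.14 L54–61, and the proof opens "Let `p ∈ ℕ_m`", L78: `m ≥ 1` is presupposed; rev. 2,
cross-read t2 2026-08-26 — without the guard the `m = 0` vacuum component, for which the tree's
`kernelNorm ε 0 K = |K ∅|` carries a volume factor, made the closed Prop false). Named fact. `Sal98.L1` ·
Salmhofer 1998 Lemma 1 · p.14 L63–76. [cite: Salmhofer1998, Lemma 1 (p.14 L63–76)] -/
def DeterminantNormBound : Prop :=
  ∀ (Γ : Type) [Fintype Γ] [DecidableEq Γ] (ε : ℝ), 0 < ε →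
    ∀ (mbar : ℕ → ℕ) (D Ddot : ℝ → Γ → Γ → ℂ) (G₁ G₂ : KernelFamily Γ) (A : ℕ → ℝ → ℝ) (t : ℝ),
      (∀ (i : ℕ) (Y Z : Fin i → Γ), ‖(covMatrix (D t) Y Z).det‖ ≤ A i t) →
        ∀ (m r : ℕ), 1 ≤ m →
          sNorm ε (quadTerm ε mbar D Ddot G₁ G₂ m r t) ≤
            Complex.re (kappaSum mbar m r fun r₁ m₁ r₂ m₂ i =>
              (((i : ℝ) ^ 2 * A (i - 1) t * sNorm ε (twoPt (Ddot t)) * sNorm ε (G₁ m₁ r₁ t) *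
                sNorm ε (G₂ m₂ r₂ t) : ℝ) : ℂ))

/-- **(4.6) `\Dform`, the covariance form of Lemma 2 / Theorem 1** (p.14 L118–135): `Λ` is a discrete
torus (a finite abelian group) with dual momenta `k ∈ Λ*` acting through characters `e^{ikx}`
(`∫_{Λ*} dk = ε_* Σ_k`, `Λ* = -Λ*`), `Γ = Λ × N × {1,2}` with `|N| = n` internal (spin/colour) indices, and
`D_t((x,σ,j),(x',σ',j')) = δ_{j',3-j} ∫_{Λ*} dk e^{ik(x-x')} (-1)^j D̂_t((-1)^j k) M_{σσ'}((-1)^j k)`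
with `M(k)` a real symmetric matrix with eigenvalues in `[-1,1]` (here: `|⟨v, M v⟩| ≤ ⟨v, v⟩`).  The index
`j ∈ {1,2}` is `Fin 2` (`0 ↦ 1 = ψ̄`, `1 ↦ 2 = ψ`). `Sal98.L2` · Salmhofer 1998 Lemma 2 (4.6) · p.14
L118–135. [cite: Salmhofer1998, Lemma 2 (p.14 L118–135)] -/
structure DForm (Λ : Type*) [AddCommGroup Λ] [Fintype Λ] (Λs N : Type*) [Fintype Λs] [Fintype N]
    (χ : Λs → Λ → ℂ) (neg : Λs → Λs) (εs : ℝ) (Dhat : ℝ → Λs → ℂ) (M : Λs → Matrix N N ℝ)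
    (D : ℝ → (Λ × N × Fin 2) → (Λ × N × Fin 2) → ℂ) : Prop where
  char_add : ∀ (k : Λs) (x y : Λ), χ k (x + y) = χ k x * χ k y
  char_norm : ∀ (k : Λs) (x : Λ), ‖χ k x‖ = 1
  neg_invol : ∀ k : Λs, neg (neg k) = k
  char_neg : ∀ (k : Λs) (x : Λ), χ (neg k) x = (starRingEnd ℂ) (χ k x)
  εs_pos : 0 < εs
  symm_M : ∀ k : Λs, (M k).IsSymm
  contraction_M : ∀ (k : Λs) (v : N → ℝ), |v ⬝ᵥ (M k).mulVec v| ≤ v ⬝ᵥ v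
  form : ∀ (t : ℝ) (x x' : Λ) (σ σ' : N) (j j' : Fin 2),
    D t (x, σ, j) (x', σ', j') =
      if j' ≠ j then
        (εs : ℂ) * ∑ k : Λs,
          χ k (x - x') * (-1 : ℂ) ^ (j.val + 1) *
            Dhat t (if j = 0 then neg k else k) * ((M (if j = 0 then neg k else k)) σ σ' : ℂ)
      else 0

/-- **Lemma 2 (p.14 L126–142)**, as printed (wave-optional licence F-080): for `D_t` of the form (4.6),
`D_t(X', X) = -D_t(X, X')` and `|det 𝒟_t^{(i-1)}(Y,Z)| ≤ (∫_{Λ*} dk |D̂_t(k)|)^{i-1}` for all `i ≥ 1`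
(Gram's bound; cf. the tree's `GramDeterminantBound.norm_det_momentumKernel_le` for the Hubbard torus).
Named fact. `Sal98.L2` · Salmhofer 1998 Lemma 2 · p.14 L126–142. [cite: Salmhofer1998, Lemma 2 (p.14 L126–142)] -/
def CovarianceGramBound : Prop :=
  ∀ (Λ : Type) [AddCommGroup Λ] [Fintype Λ] (Λs N : Type) [Fintype Λs] [Fintype N] [DecidableEq N]
    (χ : Λs → Λ → ℂ) (neg : Λs → Λs) (εs : ℝ) (Dhat : ℝ → Λs → ℂ) (M : Λs → Matrix N N ℝ)
    (D : ℝ → (Λ × N × Fin 2) → (Λ × N × Fin 2) → ℂ),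
    DForm Λ Λs N χ neg εs Dhat M D →
      ∀ t : ℝ,
        (∀ X X' : Λ × N × Fin 2, D t X' X = -D t X X') ∧
          ∀ (i : ℕ) (Y Z : Fin (i - 1) → Λ × N × Fin 2),
            ‖(covMatrix (D t) Y Z).det‖ ≤ (εs * ∑ k : Λs, ‖Dhat t k‖) ^ (i - 1)

/-- The recursion (4.17) for the constants `γ_{mr}` of Theorem 1 (p.15 L41–47):
`γ_{mr} = ‖G_{mr}(0)‖ + 3Δ₂ (1/m) ∫dκ̃_{mr} i² Δ₁^{i-1} γ_{m₁r₁} γ_{m₂r₂}`, with `∫dκ̃` the truncated measure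
(`m₁, m₂ ≥ 4`; a four-legged factor contributes `‖v‖ δ_{r_k,1}`, `v = G_{4,1}(0)`).  Typed as the
predicate "`γ` satisfies (4.17)" (the recursion determines `γ` uniquely by induction on `r`).
`Sal98.T1` · Salmhofer 1998 Theorem 1 (4.17) · p.15 L41–47. [cite: Salmhofer1998, Theorem 1 (4.17) (p.15 L41–47)] -/
def IsTruncatedGamma (ε : ℝ) (mbar : ℕ → ℕ) (G0 : (m : ℕ) → ℕ → (Fin m → Γ) → ℂ) (Δ₁ Δ₂ : ℝ)
    (γ : ℕ → ℕ → ℝ) : Prop :=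
  let γtr : ℕ → ℕ → ℝ := fun m r =>
    if m < 4 then 0 else if m = 4 then (if r = 1 then sNorm ε (G0 4 1) else 0) else γ m r
  ∀ m r : ℕ, γ m r = sNorm ε (G0 m r) +
    3 * Δ₂ * (1 / (m : ℝ)) *
      Complex.re (kappaSum mbar m r fun r₁ m₁ r₂ m₂ i =>
        (((i : ℝ) ^ 2 * Δ₁ ^ (i - 1) * γtr m₁ r₁ * γtr m₂ r₂ : ℝ) : ℂ))

/-- **Theorem 1 (p.15 L12–47), power counting for the truncated flow**, as printed: let `Γ = Λ × N × {1,2}`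
and `D_t` be of the form (4.6) with `∫_{Λ*} dk |D̂_t(k)| ≤ Δ₁ e^{-t}` (4.14) and `‖Ḋ_t‖ ≤ Δ₂ e^{t}` (4.15)
(`Ḋ_t = ∂_t D_t`).  Then the solution `G̃_{mr}(t)` of the component RGE truncated as in the theorem
(`m₁, m₂ ≥ 4`, four-legged insertions frozen to `v δ_{r,1}`) with initial condition `G_{mr}(0)` satisfies
`‖G̃_{mr}(t)‖ ≤ γ_{mr} e^{t(m/2-2)}` for `m ≥ 6`, `≤ γ_{4r}(1+t)` for `m = 4`, `≤ γ_{2r}` for `m = 2`, for all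
`t ≥ 0`, with `γ_{mr}` given by (4.17).  Named fact (licence F-081). `Sal98.T1` · Salmhofer 1998 Theorem 1 ·
p.15 L12–47. [cite: Salmhofer1998, Theorem 1 (p.15 L12–47)] -/
def TruncatedPowerCounting : Prop :=
  ∀ (Λ : Type) [AddCommGroup Λ] [Fintype Λ] [DecidableEq Λ] (Λs N : Type) [Fintype Λs] [Fintype N]
    [DecidableEq N] (χ : Λs → Λ → ℂ) (neg : Λs → Λs) (εs : ℝ) (Dhat : ℝ → Λs → ℂ) (M : Λs → Matrix N N ℝ)
    (D Ddot : ℝ → (Λ × N × Fin 2) → (Λ × N × Fin 2) → ℂ) (ε : ℝ) (mbar : ℕ → ℕ) (Δ₁ Δ₂ : ℝ),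
    0 < ε → DForm Λ Λs N χ neg εs Dhat M D →
    (∀ (t : ℝ) (X X' : Λ × N × Fin 2), HasDerivAt (fun s => D s X X') (Ddot t X X') t) →
    (∀ t : ℝ, 0 ≤ t → εs * ∑ k : Λs, ‖Dhat t k‖ ≤ Δ₁ * Real.exp (-t)) →
    (∀ t : ℝ, 0 ≤ t → sNorm ε (twoPt (Ddot t)) ≤ Δ₂ * Real.exp t) →
    ∀ (G : KernelFamily (Λ × N × Fin 2)) (γ : ℕ → ℕ → ℝ),
      IsTruncatedRGESolution ε mbar D Ddot G →
      IsTruncatedGamma ε mbar (fun m r X => G m r 0 X) Δ₁ Δ₂ γ →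
        ∀ (m r : ℕ) (t : ℝ), 0 ≤ t →
          (6 ≤ m → sNorm ε (G m r t) ≤ γ m r * Real.exp (t * ((m : ℝ) / 2 - 2))) ∧
          (m = 4 → sNorm ε (G m r t) ≤ γ m r * (1 + t)) ∧
          (m = 2 → sNorm ε (G m r t) ≤ γ m r)

/-- The UNTRUNCATED recursion of Remark 2 / Theorem 2 (p.15 L96–105): `γ_{m1} = γ^{(0)}_{m1}` and for
`r ≥ 2`, `γ_{mr} = γ^{(0)}_{mr} + A (1/m) ∫dκ_{mr} i² B^{i-1} γ_{m₁r₁} γ_{m₂r₂}` (for `r = 1` the `κ`-sum is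
empty). `Sal98.T2` · Salmhofer 1998 Remark 2 (4.18) · p.15 L96–105. [cite: Salmhofer1998, Remark 2 (p.15 L96–105)] -/
def IsUntruncatedGamma (mbar : ℕ → ℕ) (γ0 : ℕ → ℕ → ℝ) (A B : ℝ) (γ : ℕ → ℕ → ℝ) : Prop :=
  ∀ m r : ℕ, γ m r = γ0 m r +
    A * (1 / (m : ℝ)) *
      Complex.re (kappaSum mbar m r fun r₁ m₁ r₂ m₂ i =>
        (((i : ℝ) ^ 2 * B ^ (i - 1) * γ m₁ r₁ * γ m₂ r₂ : ℝ) : ℂ))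

/-- **Theorem 2 (p.20 L163–172)**, typed with "the many-fermion model in `d ≥ 1`" (at inverse temperature
`β`, scale `ε₀`, `βε₀ ≥ 6`) unfolded into the three printed properties of its cutoff covariance that the
printed proof (p.20 L174–200) invokes: (4.6) with `M = 1` and `D_t ≡ 0` for `t > log(βε₀)` (Proposition
4), `∫_{Λ*} dk |D̂_t(k)| ≤ 8 J₁ ε₀ e^{-t}` ((5.21)/Corollary 1, "so `Δ₁ ≤ 8J₁ε₀`"), and `‖Ḋ_t‖ ≤ Δ₂ e^{td}`
(Lemma 5); and the DEGREE of the order-`r` effective action of the (quartic) many-fermion model,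
`m̄(r) ≤ 2r + 2` (the model's interaction is a four-fermion term, p.5 L28–50, with initial condition
`G_{mr}(0) = -δ_{r1}V_m`, p.12 L158–161, whence `deg 𝒢_r ≤ 2r+2`, Lemma 3 p.18 L146; the printed proof
uses it as "by `r ≥ m/4`", p.20 L196–197 — rev. 2, cross-read t2 2026-08-26: without it the closed Prop
claimed the theorem for effective actions of arbitrary degree).  CONCLUSION AS PRINTED: the
(untruncated) Green functions with `‖G_{mr}(0)‖ = γ^{(0)}_{mr}` obey `‖G_{mr}(t)‖ ≤ γ_{mr} (ε₀β)^{(r-1)d}`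
for `m ≥ 1` legs (the norm (4.4) and the `1/m` of (4.18) presuppose `m ≥ 1`; rev. 2) with `γ_{mr}` from the
untruncated recursion with `A = 8Δ₂/(ε₀ d)`, `B = 8 J₁ ε₀`.  Establishing the three covariance properties
for the concrete covariance (5.9) is the content of Proposition 4 / (5.21) / Lemma 5 (DAG file F7c);
finite `(n_τ, L)` as licensed by §5 ¶2.  (On signs: (4.3) p.14 L46–52 prints no overall sign where
Proposition 2, p.12 L72–76, has `-∂_t det`; `IsRGESolution` follows (4.3) — immaterial for every norm
statement here.)  Named fact (licence F-087). `Sal98.T2` · Salmhofer 1998 Theorem 2 · p.20 L163–200.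
[cite: Salmhofer1998, Theorem 2 (p.20 L163–200)] -/
def ManyFermionGreenFunctionBound : Prop :=
  ∀ (d : ℕ), 1 ≤ d →
  ∀ (Λ : Type) [AddCommGroup Λ] [Fintype Λ] [DecidableEq Λ] (Λs N : Type) [Fintype Λs] [Fintype N]
    [DecidableEq N] (χ : Λs → Λ → ℂ) (neg : Λs → Λs) (εs : ℝ) (Dhat : ℝ → Λs → ℂ)
    (D Ddot : ℝ → (Λ × N × Fin 2) → (Λ × N × Fin 2) → ℂ) (ε : ℝ) (mbar : ℕ → ℕ) (β eps0 J₁ Δ₂ : ℝ),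
    0 < ε → 0 < eps0 → eps0 ≤ 1 → 6 ≤ β * eps0 → 0 ≤ J₁ → 0 ≤ Δ₂ →
    (∀ r : ℕ, mbar r ≤ 2 * r + 2) →
    DForm Λ Λs N χ neg εs Dhat (fun _ => (1 : Matrix N N ℝ)) D →
    (∀ (t : ℝ) (X X' : Λ × N × Fin 2), HasDerivAt (fun s => D s X X') (Ddot t X X') t) →
    (∀ t : ℝ, Real.log (β * eps0) < t → ∀ X X' : Λ × N × Fin 2, D t X X' = 0) →
    (∀ t : ℝ, 0 ≤ t → εs * ∑ k : Λs, ‖Dhat t k‖ ≤ 8 * J₁ * eps0 * Real.exp (-t)) →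
    (∀ t : ℝ, 0 ≤ t → sNorm ε (twoPt (Ddot t)) ≤ Δ₂ * Real.exp (t * d)) →
    ∀ (G : KernelFamily (Λ × N × Fin 2)) (γ : ℕ → ℕ → ℝ),
      IsRGESolution ε mbar D Ddot G →
      IsUntruncatedGamma mbar (fun m r => sNorm ε (G m r 0)) (8 * Δ₂ / (eps0 * d)) (8 * J₁ * eps0) γ →
        ∀ (m r : ℕ) (t : ℝ), 0 ≤ t → 1 ≤ m → 1 ≤ r →
          sNorm ε (G m r t) ≤ γ m r * (eps0 * β) ^ ((r - 1) * d)

end ComponentRGE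

end Salmhofer1998

end Literature.MathematicalPhysics.QuantumLattice.FermiRG
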